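import Summits.RiemannHypothesis.RiemannHypothesis.Theorems.TiltedLandingLaw421R3RateChildCountA

/-! # RATE CHILD COUNT (B) — downward zeros on the diameter and EXISTENCE of the upper child from the count
(lens-2 g4, crux item stmt-RiemannHypothesis-33346; module 2/3 of the (CA557) cut; namespace `RhW08.ChildCount`; imports (A) only; 0 `sorry`.)

§3 real-axis bookkeeping for a `C¹` function all of whose zeros on `[α, β]` are DOWNWARD (`φ′ < 0`): `sign_near_downward_zero`,
`pos_left_of_downward`, `neg_right_of_downward`, `card_le_one_of_downward` (at most one zero; positive to its left, negative to its right).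
§4 `eq_feet_of_real_on_circle` and ★★★ `exists_upper_child`: in the setting of `childCount` (A), if moreover `G` is real on `ℝ`, every REAL
critical point `x` of `G` on the closed diameter `|x − a| ≤ b` has `G(x)·G″(x) < 0` («no NL event») and `G′ ≠ 0` at the two feet `a ± b`, then
`G′` has a NON-REAL zero `w` with `Im w > 0`, `G(w) ≠ 0`, `‖w − a‖ ≤ b` (the count is `#real + 2`; boundary critical points by a direct case split).
Nothing here bears on the truth of RH; RH is not proved; 33346/33347 OPEN; checked ≠ proved. -/

noncomputable section

open Complex Metric Set
open scoped Real ComplexConjugate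
open Literature.Topology.PlaneTopology
open Literature.Analysis.Complex
open RhW08.IsolatedTilt (pairQ)

namespace RhW08.ChildCount

/-! ## §3 real axis: a function all of whose zeros are DOWNWARD (`φ′ < 0`) has at most one zero, is positive to the left of it and negative
to the right — elementary IVT bookkeeping (the «no NL event on the diameter» input of §4) -/

/-- (K) local sign at a downward zero. -/
theorem sign_near_downward_zero {φ : ℝ → ℝ} {x d : ℝ} (h0 : φ x = 0) (hd : HasDerivAt φ d x) (hneg : d < 0) :
    ∃ δ > 0, (∀ y, x < y → y < x + δ → φ y < 0) ∧ (∀ y, x - δ < y → y < x → 0 < φ y) := by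
  have ht := hasDerivAt_iff_tendsto_slope.1 hd
  have hev : ∀ᶠ y in nhdsWithin x {x}ᶜ, slope φ x y < 0 := (tendsto_order.1 ht).2 0 hneg
  rw [eventually_nhdsWithin_iff, Metric.eventually_nhds_iff] at hev
  obtain ⟨δ, hδ, hδ'⟩ := hev
  refine ⟨δ, hδ, fun y h1 h2 => ?_, fun y h1 h2 => ?_⟩
  · have hy : y ∈ ({x}ᶜ : Set ℝ) := fun h => by simp only [mem_singleton_iff] at h; linarith
    have := hδ' (by rw [Real.dist_eq, abs_of_pos (by linarith)]; linarith) hy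
    rw [slope_def_field, h0, sub_zero] at this
    have := (div_lt_iff₀ (by linarith : 0 < y - x)).1 this
    linarith
  · have hy : y ∈ ({x}ᶜ : Set ℝ) := fun h => by simp only [mem_singleton_iff] at h; linarith
    have := hδ' (by rw [Real.dist_eq, abs_of_neg (by linarith)]; linarith) hy
    rw [slope_def_field, h0, sub_zero] at this
    have := (div_lt_iff_of_neg (by linarith : y - x < 0)).1 this
    linarith

/-- (K) if every zero of `φ` in `[α, β]` lies in the finite set `T ⊂ (α, β)` of downward zeros and `T ≠ ∅`, then `0 < φ α`. -/
theorem pos_left_of_downward {φ : ℝ → ℝ} {α β : ℝ} (hφ : ContinuousOn φ (Icc α β)) (T : Finset ℝ)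
    (hT : ∀ x ∈ Icc α β, φ x = 0 → x ∈ T) (hTsub : ∀ x ∈ T, x ∈ Ioo α β ∧ φ x = 0)
    (hdown : ∀ x ∈ T, ∃ d < 0, HasDerivAt φ d x) (hne : T.Nonempty) : 0 < φ α := by
  set x₁ := T.min' hne with hx₁
  have hx₁T : x₁ ∈ T := T.min'_mem hne
  obtain ⟨⟨hαx, hxβ⟩, hz⟩ := hTsub x₁ hx₁T
  obtain ⟨d, hd, hder⟩ := hdown x₁ hx₁T
  obtain ⟨δ, hδ, -, hleft⟩ := sign_near_downward_zero hz hder hd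
  set y := max α (x₁ - δ / 2) with hy
  have hy1 : y < x₁ := max_lt hαx (by linarith)
  have hy2 : x₁ - δ < y := lt_of_lt_of_le (by linarith) (le_max_right _ _)
  have hφy : 0 < φ y := hleft y hy2 hy1
  have hαy : α ≤ y := le_max_left _ _
  by_contra hneg
  push Not at hneg
  have hα0 : φ α ≠ 0 := fun h => by
    have := (hTsub α (hT α ⟨le_rfl, by linarith⟩ h)).1.1; linarith
  have hcont : ContinuousOn φ (Icc α y) := hφ.mono (Icc_subset_Icc le_rfl (by linarith))
  obtain ⟨z, hz1, hz2⟩ := intermediate_value_Icc hαy hcont ⟨hneg, hφy.le⟩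
  have hzT := hT z ⟨hz1.1, by linarith [hz1.2]⟩ hz2
  have := T.min'_le z hzT
  linarith [hz1.2]

/-- (K) … and `φ β < 0`. -/
theorem neg_right_of_downward {φ : ℝ → ℝ} {α β : ℝ} (hφ : ContinuousOn φ (Icc α β)) (T : Finset ℝ)
    (hT : ∀ x ∈ Icc α β, φ x = 0 → x ∈ T) (hTsub : ∀ x ∈ T, x ∈ Ioo α β ∧ φ x = 0)
    (hdown : ∀ x ∈ T, ∃ d < 0, HasDerivAt φ d x) (hne : T.Nonempty) : φ β < 0 := by
  set x₂ := T.max' hne with hx₂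
  have hx₂T : x₂ ∈ T := T.max'_mem hne
  obtain ⟨⟨hαx, hxβ⟩, hz⟩ := hTsub x₂ hx₂T
  obtain ⟨d, hd, hder⟩ := hdown x₂ hx₂T
  obtain ⟨δ, hδ, hright, -⟩ := sign_near_downward_zero hz hder hd
  set y := min β (x₂ + δ / 2) with hy
  have hy1 : x₂ < y := lt_min hxβ (by linarith)
  have hy2 : y < x₂ + δ := lt_of_le_of_lt (min_le_right _ _) (by linarith)
  have hφy : φ y < 0 := hright y hy1 hy2
  have hyβ : y ≤ β := min_le_left _ _
  by_contra hpos
  push Not at hpos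
  have hβ0 : φ β ≠ 0 := fun h => by
    have := (hTsub β (hT β ⟨by linarith, le_rfl⟩ h)).1.2; linarith
  have hcont : ContinuousOn φ (Icc y β) := hφ.mono (Icc_subset_Icc (by linarith) le_rfl)
  obtain ⟨z, hz1, hz2⟩ := intermediate_value_Icc hyβ hcont ⟨hφy.le, hpos⟩
  have hzT := hT z ⟨by linarith [hz1.1], hz1.2⟩ hz2
  have := T.le_max' z hzT
  linarith [hz1.1]

/-- (K) … and there is AT MOST ONE zero. -/
theorem card_le_one_of_downward {φ : ℝ → ℝ} {α β : ℝ} (hφ : ContinuousOn φ (Icc α β)) (T : Finset ℝ)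
    (hT : ∀ x ∈ Icc α β, φ x = 0 → x ∈ T) (hTsub : ∀ x ∈ T, x ∈ Ioo α β ∧ φ x = 0)
    (hdown : ∀ x ∈ T, ∃ d < 0, HasDerivAt φ d x) : T.card ≤ 1 := by
  by_contra hlt
  push Not at hlt
  have hne : T.Nonempty := Finset.card_pos.1 (by omega)
  set x₁ := T.min' hne with hx₁
  have hx₁T : x₁ ∈ T := T.min'_mem hne
  have hne' : (T.erase x₁).Nonempty := Finset.card_pos.1 (by rw [Finset.card_erase_of_mem hx₁T]; omega)
  set x₂ := (T.erase x₁).min' hne' with hx₂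
  have hx₂T' : x₂ ∈ T.erase x₁ := (T.erase x₁).min'_mem hne'
  have hx₂T : x₂ ∈ T := Finset.mem_of_mem_erase hx₂T'
  have h12 : x₁ < x₂ := lt_of_le_of_ne (T.min'_le x₂ hx₂T) (Finset.ne_of_mem_erase hx₂T').symm
  have hadj : ∀ z ∈ T, x₁ < z → x₂ ≤ z := fun z hz hlz =>
    (T.erase x₁).min'_le z (Finset.mem_erase.2 ⟨hlz.ne', hz⟩)
  obtain ⟨⟨hα1, h1β⟩, hz1⟩ := hTsub x₁ hx₁T
  obtain ⟨⟨hα2, h2β⟩, hz2⟩ := hTsub x₂ hx₂T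
  obtain ⟨d₁, hd₁, hder₁⟩ := hdown x₁ hx₁T
  obtain ⟨d₂, hd₂, hder₂⟩ := hdown x₂ hx₂T
  obtain ⟨δ₁, hδ₁, hright, -⟩ := sign_near_downward_zero hz1 hder₁ hd₁
  obtain ⟨δ₂, hδ₂, -, hleft⟩ := sign_near_downward_zero hz2 hder₂ hd₂
  set y₁ := min (x₁ + δ₁ / 2) ((x₁ + x₂) / 2) with hy₁
  set y₂ := max y₁ (x₂ - δ₂ / 2) with hy₂
  have hy₁1 : x₁ < y₁ := lt_min (by linarith) (by linarith)
  have hy₁2 : y₁ < x₁ + δ₁ := lt_of_le_of_lt (min_le_left _ _) (by linarith)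
  have hy₁3 : y₁ < x₂ := lt_of_le_of_lt (min_le_right _ _) (by linarith)
  have hy₂1 : y₁ ≤ y₂ := le_max_left _ _
  have hy₂2 : y₂ < x₂ := max_lt hy₁3 (by linarith)
  have hy₂3 : x₂ - δ₂ < y₂ := lt_of_lt_of_le (by linarith) (le_max_right _ _)
  have hφ1 : φ y₁ < 0 := hright y₁ hy₁1 hy₁2
  have hφ2 : 0 < φ y₂ := hleft y₂ hy₂3 hy₂2
  have hcont : ContinuousOn φ (Icc y₁ y₂) := hφ.mono (Icc_subset_Icc (by linarith) (by linarith))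
  obtain ⟨z, hzI, hz0⟩ := intermediate_value_Icc hy₂1 hcont ⟨hφ1.le, hφ2.le⟩
  have hzT := hT z ⟨by linarith [hzI.1], by linarith [hzI.2]⟩ hz0
  have := hadj z hzT (by linarith [hzI.1])
  linarith [hzI.2]

/-! ## §4 EXISTENCE (and oddness) of the nested moving child from the count: «no NL event on the closed diameter» -/

/-- (K) the real points of the Jensen circle are the two feet `a ± b`. -/
theorem eq_feet_of_real_on_circle {a b : ℝ} {z : ℂ} (hz : ‖z - a‖ = b) (hzim : z.im = 0) :
    z = (a : ℂ) + b ∨ z = (a : ℂ) - b := by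
  have e : ‖z - (a : ℂ)‖ ^ 2 = (z.re - a) ^ 2 + z.im ^ 2 := by
    rw [← Complex.normSq_eq_norm_sq, Complex.normSq_apply]; simp; ring
  rw [hz, hzim] at e
  have hsq : (z.re - a) ^ 2 = b ^ 2 := by nlinarith [e]
  rcases sq_eq_sq_iff_eq_or_eq_neg.1 hsq with h | h
  · left; exact Complex.ext (by simp; linarith) (by simp [hzim])
  · right; exact Complex.ext (by simp; linarith) (by simp [hzim])

set_option maxHeartbeats 1600000 in
/-- ★★★ (K) **THE NESTED MOVING CHILD EXISTS** (generic feet).  `G = q·h` real entire (`q = pairQ a b`, `0 < b`), `h` real entire and zero-free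
on the closed Jensen disc `‖z − a‖ ≤ b` with the Jensen sign on its boundary circle; NO NL EVENT of `G` on the closed diameter
(`G′(x) = 0 ⇒ G(x)·G″(x) < 0` for `|x − a| ≤ b`); `G′ ≠ 0` at the two feet `a ± b`.  Then `G′` has an UPPER NON-REAL zero `w` with `G(w) ≠ 0`
in the closed Jensen disc: `‖w − a‖ ≤ b`. -/
theorem exists_upper_child {G h : ℂ → ℂ} {a b ρ : ℝ} (hb : 0 < b) (hbρ : b < ρ)
    (hGd : Differentiable ℂ G) (hh : Differentiable ℂ h) (hfac : ∀ z, G z = pairQ a b z * h z)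
    (hGreal : ∀ x : ℝ, (G x).im = 0) (hhreal : ∀ x : ℝ, (h x).im = 0)
    (hh0 : ∀ z ∈ closedBall (a : ℂ) b, h z ≠ 0)
    (hsign : ∀ z : ℂ, ‖z - a‖ = b → z.im * (deriv h z / h z).im ≤ 0)
    (hnoNL : ∀ x : ℝ, |x - a| ≤ b → (deriv G x).re = 0 → (G x).re * (deriv (deriv G) x).re < 0)
    (hfeet : deriv G ((a : ℂ) + b) ≠ 0 ∧ deriv G ((a : ℂ) - b) ≠ 0) :
    ∃ w : ℂ, deriv G w = 0 ∧ G w ≠ 0 ∧ 0 < w.im ∧ ‖w - a‖ ≤ b := by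
  classical
  -- realness and symmetry
  have hG'd : Differentiable ℂ (deriv G) := by
    have := differentiable_iteratedDeriv_of_entire hGd 1; rwa [iteratedDeriv_one] at this
  have hG'real : ∀ x : ℝ, (deriv G x).im = 0 := fun x => by
    have := im_iteratedDeriv_ofReal hGd hGreal 1 x; rwa [iteratedDeriv_one] at this
  have hh'real : ∀ x : ℝ, (deriv h x).im = 0 := fun x => by
    have := im_iteratedDeriv_ofReal hh hhreal 1 x; rwa [iteratedDeriv_one] at this
  have hderiv : ∀ z, deriv G z = 2 * (z - a) * h z + pairQ a b z * deriv h z := by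
    intro z
    have e : G = fun w => pairQ a b w * h w := funext hfac
    rw [e]
    exact ((RhW07.Law421.SuccessorCertificate.hasDerivAt_quadP a b z).mul (hh z).hasDerivAt).deriv
  have hq0 : ∀ u : ℂ, pairQ a b u = 0 → ‖u - a‖ = b := by
    intro u hu
    rw [RhW08.IsolatedTilt.pairQ_eq_mul] at hu
    rcases mul_eq_zero.1 hu with h | h
    · rw [sub_eq_zero] at h; rw [h]; simp [abs_of_pos hb]
    · rw [sub_eq_zero] at h; rw [h]; simp [abs_of_pos hb]
  have hGne : ∀ u : ℂ, ‖u - a‖ ≤ b → deriv G u = 0 → G u ≠ 0 := by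
    intro u hu hu0 hG0
    have hhu : h u ≠ 0 := hh0 u (by rw [mem_closedBall, dist_eq_norm]; exact hu)
    rw [hfac u] at hG0
    rcases mul_eq_zero.1 hG0 with hq | hh'
    · have e := hderiv u
      rw [hu0, hq, zero_mul, add_zero] at e
      have hua : u - a ≠ 0 := by
        intro h0; have := hq0 u hq; rw [h0, norm_zero] at this; exact hb.ne' this.symm
      exact hhu ((mul_eq_zero.1 e.symm).resolve_left (mul_ne_zero two_ne_zero hua))
    · exact hhu hh'
  have hconj : ∀ z, deriv G (conj z) = conj (deriv G z) := apply_conj_eq_conj hG'd hG'real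
  have hnorm_conj : ∀ z : ℂ, ‖conj z - a‖ = ‖z - a‖ := by
    intro z; rw [← Complex.norm_conj (z - a), map_sub, Complex.conj_ofReal]
  -- a non-real critical point ON the circle settles it
  by_cases hex : ∃ w : ℂ, ‖w - a‖ = b ∧ w.im ≠ 0 ∧ deriv G w = 0
  · obtain ⟨w, hw, hwim, hw0⟩ := hex
    rcases lt_or_gt_of_ne hwim with hneg | hpos
    · have hc0 : deriv G (conj w) = 0 := by rw [hconj, hw0, map_zero]
      exact ⟨conj w, hc0, hGne _ (by rw [hnorm_conj]; exact hw.le) hc0, by rw [conj_im]; linarith,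
        by rw [hnorm_conj]; exact hw.le⟩
    · exact ⟨w, hw0, hGne w hw.le hw0, hpos, hw.le⟩
  push Not at hex
  have hcirc : ∀ z : ℂ, ‖z - a‖ = b → deriv G z ≠ 0 := by
    intro z hz
    by_cases hzim : z.im = 0
    · rcases eq_feet_of_real_on_circle hz hzim with h | h
      · rw [h]; exact hfeet.1
      · rw [h]; exact hfeet.2
    · exact hex z hz hzim
  have hKreal : ∀ x : ℝ, ‖(x : ℂ) - a‖ = b → (deriv h x / h x).im = 0 := by
    intro x _
    have e1 : deriv h x = (((deriv h x).re : ℝ) : ℂ) := Complex.ext (by rw [ofReal_re]) (by rw [ofReal_im]; exact hh'real x)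
    have e2 : h x = (((h x).re : ℝ) : ℂ) := Complex.ext (by rw [ofReal_re]) (by rw [ofReal_im]; exact hhreal x)
    rw [e1, e2, ← ofReal_div, ofReal_im]
  have hcount := childCount hb hbρ hGd.differentiableOn hh.differentiableOn (fun z _ => hfac z) hh0 hsign hKreal hcirc
  -- suppose there is no nested upper child
  by_contra hne
  push Not at hne
  -- then every critical point in the closed disc is real …
  have hzr : ∀ u ∈ closedBall (a : ℂ) b, deriv G u = 0 → u.im = 0 := by
    intro u hu hu0
    rw [mem_closedBall, dist_eq_norm] at hu
    by_contra him
    rcases lt_or_gt_of_ne him with hneg | hpos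
    · have hc0 : deriv G (conj u) = 0 := by rw [hconj, hu0, map_zero]
      have h1 := hne (conj u) hc0 (hGne _ (by rw [hnorm_conj]; exact hu) hc0) (by rw [conj_im]; linarith)
      rw [hnorm_conj] at h1; linarith
    · have h1 := hne u hu0 (hGne u hu hu0) hpos; linarith
  -- … and simple
  have hzs : ∀ u ∈ closedBall (a : ℂ) b, deriv G u = 0 → deriv (deriv G) u ≠ 0 := by
    intro u hu hu0
    have him := hzr u hu hu0
    rw [mem_closedBall, dist_eq_norm] at hu
    have hux : u = ((u.re : ℝ) : ℂ) := Complex.ext (by rw [ofReal_re]) (by rw [ofReal_im]; exact him)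
    have habs : |u.re - a| ≤ b := by
      have := Complex.abs_re_le_norm (u - a); simp only [sub_re, ofReal_re] at this; exact this.trans hu
    have h0 : (deriv G (u.re : ℝ)).re = 0 := by rw [← hux, hu0]; simp
    have := hnoNL u.re habs h0
    intro hd
    rw [hux] at hd
    rw [hd] at this
    simp at this
  have hm := Rouche.finsum_divisor_eq_ncard_zeros (deriv G) hb hbρ hG'd.differentiableOn hcirc hzs
  -- the real zero set of `G′` on the open diameter
  set Z : Set ℝ := {x | x ∈ Ioo (a - b) (a + b) ∧ (deriv G x).re = 0} with hZ
  have hZim : {u : ℂ | ‖u - (a : ℂ)‖ < b ∧ deriv G u = 0} = (fun x : ℝ => (x : ℂ)) '' Z := by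
    ext u
    constructor
    · rintro ⟨hu, hu0⟩
      have him := hzr u (by rw [mem_closedBall, dist_eq_norm]; exact hu.le) hu0
      have hux : u = ((u.re : ℝ) : ℂ) := Complex.ext (by rw [ofReal_re]) (by rw [ofReal_im]; exact him)
      refine ⟨u.re, ⟨?_, ?_⟩, hux.symm⟩
      · have h1 : |u.re - a| ≤ ‖u - (a : ℂ)‖ := by
          have := Complex.abs_re_le_norm (u - a); simpa only [sub_re, ofReal_re] using this
        have h2 := abs_lt.1 (lt_of_le_of_lt h1 hu)
        exact ⟨by linarith [h2.1], by linarith [h2.2]⟩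
      · rw [← hux, hu0]; simp
    · rintro ⟨x, ⟨hx, hx0⟩, rfl⟩
      refine ⟨?_, Complex.ext (by rw [zero_re]; exact hx0) (by rw [zero_im]; exact hG'real x)⟩
      rw [← ofReal_sub, Complex.norm_real, Real.norm_eq_abs, abs_lt]
      exact ⟨by linarith [hx.1], by linarith [hx.2]⟩
  have hfin : Z.Finite := by
    have hf := Rouche.finite_zeros (deriv G) hb hbρ hG'd.differentiableOn hcirc
    refine Set.Finite.of_finite_image ?_ Complex.ofReal_injective.injOn
    rw [← hZim]
    exact hf.subset fun u ⟨hu, hu0⟩ => ⟨by rw [mem_closedBall, dist_eq_norm]; exact hu.le, hu0⟩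
  have hncard : ({u : ℂ | ‖u - (a : ℂ)‖ < b ∧ deriv G u = 0}.ncard : ℤ) = (hfin.toFinset.card : ℤ) := by
    rw [hZim, Set.ncard_image_of_injective _ Complex.ofReal_injective, Set.ncard_eq_toFinset_card _ hfin]
  -- the real function `φ = Re G′ / Re G` on the closed diameter: continuous, zeros = real critical points, all DOWNWARD
  set φ : ℝ → ℝ := fun x => (deriv G x).re / (G x).re with hφ
  have hball : ∀ x : ℝ, |x - a| ≤ b → (x : ℂ) ∈ closedBall (a : ℂ) b := fun x hx => by
    rw [mem_closedBall, dist_eq_norm, ← ofReal_sub, Complex.norm_real, Real.norm_eq_abs]; exact hx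
  have hGx : ∀ x : ℝ, |x - a| ≤ b → (G x).re ≠ 0 := by
    intro x hx h0
    have hGx0 : G x = 0 := Complex.ext (by rw [zero_re]; exact h0) (by rw [zero_im]; exact hGreal x)
    rw [hfac] at hGx0
    rcases mul_eq_zero.1 hGx0 with hq | hh'
    · have eq : pairQ a b (x : ℂ) = ((((x - a) ^ 2 + b ^ 2 : ℝ)) : ℂ) := by simp only [pairQ]; push_cast; ring
      have hQ : 0 < (x - a) ^ 2 + b ^ 2 := by positivity
      rw [eq] at hq
      exact hQ.ne' (by exact_mod_cast hq)
    · exact hh0 _ (hball x hx) hh'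
  have hφc : ContinuousOn φ (Icc (a - b) (a + b)) := by
    have c1 : Continuous fun x : ℝ => (deriv G x).re :=
      Complex.continuous_re.comp (hG'd.continuous.comp Complex.continuous_ofReal)
    have c2 : Continuous fun x : ℝ => (G x).re :=
      Complex.continuous_re.comp (hGd.continuous.comp Complex.continuous_ofReal)
    exact c1.continuousOn.div c2.continuousOn fun x hx => hGx x (abs_le.2 ⟨by linarith [hx.1], by linarith [hx.2]⟩)
  have hφzero : ∀ x : ℝ, |x - a| ≤ b → (φ x = 0 ↔ (deriv G x).re = 0) := by
    intro x hx
    simp only [hφ, div_eq_zero_iff]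
    exact ⟨fun h => h.resolve_right (hGx x hx), Or.inl⟩
  have hdown : ∀ x : ℝ, |x - a| ≤ b → φ x = 0 → ∃ d < 0, HasDerivAt φ d x := by
    intro x hx h0
    have h0' := (hφzero x hx).1 h0
    have h1 : HasDerivAt (fun y : ℝ => (deriv G y).re) (deriv (deriv G) x).re x :=
      (hG'd x).hasDerivAt.real_of_complex
    have h2 : HasDerivAt (fun y : ℝ => (G y).re) (deriv G x).re x := (hGd x).hasDerivAt.real_of_complex
    refine ⟨_, ?_, h1.div h2 (hGx x hx)⟩
    rw [h0', zero_mul, sub_zero]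
    have := hnoNL x hx h0'
    have hsq : 0 < (G x).re ^ 2 := lt_of_le_of_ne (sq_nonneg _) (Ne.symm (pow_ne_zero 2 (hGx x hx)))
    have hc : (deriv (deriv G) ↑x).re * (G ↑x).re < 0 := by rw [mul_comm]; exact this
    exact div_neg_of_neg_of_pos hc hsq
  -- the finite set `T` of real critical points and the three real-axis lemmas of §3
  set T := hfin.toFinset with hT
  have hTmem : ∀ x, x ∈ T ↔ x ∈ Ioo (a - b) (a + b) ∧ (deriv G x).re = 0 := fun x => by
    rw [hT, Set.Finite.mem_toFinset]; rfl
  have hreal_zero : ∀ x : ℝ, (deriv G x).re = 0 → deriv G x = 0 := fun x h0 =>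
    Complex.ext (by rw [zero_re]; exact h0) (by rw [zero_im]; exact hG'real x)
  have hT1 : ∀ x ∈ Icc (a - b) (a + b), φ x = 0 → x ∈ T := by
    intro x hx h0
    have hxa : |x - a| ≤ b := abs_le.2 ⟨by linarith [hx.1], by linarith [hx.2]⟩
    have h0' := (hφzero x hxa).1 h0
    rw [hTmem]
    refine ⟨⟨lt_of_le_of_ne hx.1 ?_, lt_of_le_of_ne hx.2 ?_⟩, h0'⟩
    · intro h
      apply hfeet.2
      have e : ((x : ℝ) : ℂ) = (a : ℂ) - b := by rw [← h]; push_cast; ring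
      rw [← e]; exact hreal_zero x h0'
    · intro h
      apply hfeet.1
      have e : ((x : ℝ) : ℂ) = (a : ℂ) + b := by rw [h]; push_cast; ring
      rw [← e]; exact hreal_zero x h0'
  have hT2 : ∀ x ∈ T, x ∈ Ioo (a - b) (a + b) ∧ φ x = 0 := by
    intro x hx
    rw [hTmem] at hx
    exact ⟨hx.1, (hφzero x (abs_le.2 ⟨by linarith [hx.1.1], by linarith [hx.1.2]⟩)).2 hx.2⟩
  have hT3 : ∀ x ∈ T, ∃ d < 0, HasDerivAt φ d x := fun x hx =>
    hdown x (abs_le.2 ⟨by linarith [(hT2 x hx).1.1], by linarith [(hT2 x hx).1.2]⟩) (hT2 x hx).2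
  -- the value of `φ` on the diameter and at the two feet
  have hφval : ∀ x : ℝ, |x - a| ≤ b → φ x = 2 * (x - a) / ((x - a) ^ 2 + b ^ 2) + (deriv h x / h x).re := by
    intro x hx
    have hu0 : (h x).re ≠ 0 := by
      intro h0
      exact hh0 _ (hball x hx) (Complex.ext (by rw [zero_re]; exact h0) (by rw [zero_im]; exact hhreal x))
    have eh : h x = (((h x).re : ℝ) : ℂ) := Complex.ext (by rw [ofReal_re]) (by rw [ofReal_im]; exact hhreal x)
    have eh' : deriv h x = (((deriv h x).re : ℝ) : ℂ) :=
      Complex.ext (by rw [ofReal_re]) (by rw [ofReal_im]; exact hh'real x)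
    have eq : pairQ a b (x : ℂ) = ((((x - a) ^ 2 + b ^ 2 : ℝ)) : ℂ) := by simp only [pairQ]; push_cast; ring
    have hQ : 0 < (x - a) ^ 2 + b ^ 2 := by positivity
    have eG : G x = ((((x - a) ^ 2 + b ^ 2) * (h x).re : ℝ) : ℂ) := by
      rw [hfac, eq]; nth_rw 1 [eh]; push_cast; ring
    have eG' : deriv G x = (((2 * (x - a) * (h x).re + ((x - a) ^ 2 + b ^ 2) * (deriv h x).re : ℝ)) : ℂ) := by
      rw [hderiv, eq]; nth_rw 1 [eh]; nth_rw 1 [eh']; push_cast; ring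
    have eK : (deriv h x / h x).re = (deriv h x).re / (h x).re := by
      nth_rw 1 [eh', eh]; rw [← ofReal_div, ofReal_re]
    simp only [hφ]
    rw [eG', eG, ofReal_re, ofReal_re, eK]
    field_simp
  have hfoot1 : 1 + b * (deriv h ((a : ℂ) + b) / h ((a : ℂ) + b)).re = b * φ (a + b) := by
    have := hφval (a + b) (by rw [add_sub_cancel_left, abs_of_pos hb])
    push_cast at this
    rw [this]
    field_simp
    ring
  have hfoot2 : 1 - b * (deriv h ((a : ℂ) - b) / h ((a : ℂ) - b)).re = -(b * φ (a - b)) := by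
    have := hφval (a - b) (by rw [sub_sub_cancel_left, abs_neg, abs_of_pos hb])
    push_cast at this
    rw [this]
    field_simp
    ring
  have c1 : (b * φ (a + b) < 0) ↔ (φ (a + b) < 0) :=
    ⟨fun h => by by_contra h'; push Not at h'; nlinarith [mul_nonneg hb.le h'], fun h => mul_neg_of_pos_of_neg hb h⟩
  have c2 : (-(b * φ (a - b)) < 0) ↔ (0 < φ (a - b)) := by
    rw [neg_lt_zero]; exact mul_pos_iff_of_pos_left hb
  -- the count in terms of `T.card`
  have hcard : (T.card : ℤ) = 1 + (if φ (a + b) < 0 then 1 else 0) + (if 0 < φ (a - b) then 1 else 0) := by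
    have e := hm.symm.trans hcount
    rw [hncard, hfoot1, hfoot2] at e
    simp only [c1, c2] at e
    exact e
  rcases T.eq_empty_or_nonempty with hTe | hTne
  · simp only [hTe, Finset.card_empty, Nat.cast_zero] at hcard
    split_ifs at hcard <;> omega
  · have h1 := pos_left_of_downward hφc T hT1 hT2 hT3 hTne
    have h2 := neg_right_of_downward hφc T hT1 hT2 hT3 hTne
    have h3 := card_le_one_of_downward hφc T hT1 hT2 hT3
    rw [if_pos h2, if_pos h1] at hcard
    omega


end RhW08.ChildCount
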